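import Summits.BirchSwinnertonDyer.BirchSwinnertonDyer.Theorems.KatoDescentRankEqConjAUpperDoors
import Summits.BirchSwinnertonDyer.BirchSwinnertonDyer.Theorems.KatoDescentTamePotSupersingularTameUpperUnitTwistRecordsFlat78
import Summits.BirchSwinnertonDyer.BirchSwinnertonDyer.Theorems.KatoDescentTamePotSupersingularTameUpperUnitTwistRecordsSharp43
import Literature.NumberTheory.EllipticCurves.FineSelmerRankEqualityNonsplitCartanInertiaOrderFour
import HarnessLib

/-!
# K8-t′ U₀ record lane (k8t-c4 g27): the three KT `p = 7` rows on the RANK-EQUALITY road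

Rows `163072bq1`, `163072cb1`, `163072k1` (`N = 2^8·7^2·13`, Cremona `r_an = 0`, (t′) at `7` with semistability
defect `4`, image `7Nn` = normaliser of a non-split Cartan) — the only `p = 7` rows of the KT U₀-ns table
(item stmt-BirchSwinnertonDyer-19202 → parent stmt-BirchSwinnertonDyer-19982, derived support).

* Door `missingUpperBoundAt_seven_tame_of_nonsplitCartan_of_rankEq_of_four_dvd`: U₀ (`MissingUpperBoundAt W 7`)
  from the LAYER-0 RANK EQUALITY `#Cl(ℚ(P))[7] = #Cl(ℚ(x(P)))[7]` (k8t-c4 g25/g26 road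
  `RankEqConjAUpperDoors.missingUpperBoundAt_tame_of_rankEq`), with BOTH structural inputs of the road in the
  kernel on a `C_ns⁺(ε)` row: `7 ∤ #Gal(ℚ(E[7])/ℚ)` (`RankEqualityRoad.not_dvd_card_gal_of_nonsplitCartanNormalizer`)
  and `σ̄_m = −1 ∈ I(𝔮|7)` from `4 ∣ #I(𝔮|7)` (`RankEqualityRoad.neg_one_mem_inertia_of_four_dvd_card_inertia`,
  conjA-anchor g23, Literature `FineSelmerRankEqualityNonsplitCartanInertiaOrderFour`, p738531/p738723).
* Records `missingUpperBoundAt_g<label>_7_of_rankEq`: modulo the three named published inputs `hKatoA hGZK hmod`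
  ONLY; displayed per row: the `C_ns⁺(ε)` basis data (`e hε he σs σm σx`), `hrank` (conjA-anchor g23 kit j334924:
  `#Cl(ℚ(x(P)))[7] = 1` with `h = 1` CERTIFIED at degree 24, `#Cl(ℚ(P))[7] = 1` with `h = 1` under GRH at degree 48;
  bq1 and cb1 share both fields, k1's `ℚ(P)` is the sign twist) and `h4` (`#I(𝔮|7) = 48` EXACT: `7` is totally
  ramified in `ℚ(P)`, kit j334874). KERNEL: the row certificates `addv_/subTprime_/irr_g<label>_7` (tree,
  `…TameUpperUnitTwistRecordsFlat78` / `…Sharp43`).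

Honest framing: per-row records `--supports stmt-BirchSwinnertonDyer-19982 --as helper`; nothing is booked, no class
closes, BSD is proved for no curve; the GRH tag on `hrank` is part of the displayed datum. Turnkey file by
conjA-anchor g23 (HOME/conjA-anchor/g23/lean/RankEqSevenRecords.scratch.lean, farm rc 0), landed verbatim up to this
docstring by the record lane.
-/

set_option autoImplicit false
set_option linter.dupNamespace false

noncomputable section

open scoped Classical NumberField Matrix
open WeierstrassCurve Field IntermediateField
  Literature.NumberTheory.EllipticCurves Literature.NumberTheory.EllipticCurves.Rank1Residual
  Literature.NumberTheory.EllipticCurves.Rank1Residual.Typed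
  Literature.NumberTheory.GaloisRepresentations Literature.NumberTheory.SerreUniformity
  Literature.NumberTheory.IwasawaTheory
  Literature.NumberTheory.EllipticCurves.CoatesSujatha2005
  Summit.BirchSwinnertonDyer.Rank1Residual Summit.BirchSwinnertonDyer.Rank1Residual.Additive
  Summit.BirchSwinnertonDyer.BirchSwinnertonDyer.Theorems

namespace Summit.BirchSwinnertonDyer.BirchSwinnertonDyer.Theorems.TameRankEqRecordsSeven

/-- Door at `p = 7` (any `C_ns⁺(ε)` row of the K8-t′ table): U₀ from the layer-0 rank equality, with BOTH structural inputs of the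
rank-equality road in the kernel (`7 ∤ #Gal`, `σ̄_m ∈ I(𝔮|7)` from `4 ∣ #I(𝔮|7)`). -/
theorem missingUpperBoundAt_seven_tame_of_nonsplitCartan_of_rankEq_of_four_dvd (W : WeierstrassCurve ℚ) [W.IsElliptic] [W.IsGloballyMinimal]
    (hKatoA : Kato2004.rankZero_padicValNat_sha_add_padicValNat_tamagawa_le_of_additive_potGood_of_irreducible_of_fineSelmerDual_fg)
    (hGZK : rank_eq_analyticRank_of_analyticRank_le_one) (hmod : hasEntireLFunction_rat) [Fact (7 : ℕ).Prime]
    (hr : W.analyticRank = 0) (hadd : Addv W 7) (hT : SubTprime W 7) (hirr : W.HasIrreducibleModPGaloisRep 7)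
    (e : W.geomTorsion (7 : ℕ) ≃+ (Fin 2 → ZMod 7)) {ε : ZMod 7} (hε : ¬ IsSquare ε)
    (he : ∀ σ : absoluteGaloisGroup ℚ, ∃ M ∈ nonsplitCartanNormalizer ε, ∀ P : W.geomTorsion (7 : ℕ), e (σ • P) = M *ᵥ e P)
    (σs σm σx : absoluteGaloisGroup ℚ)
    (hσs : ∀ P : W.geomTorsion (7 : ℕ), e (σs • P) = !![1, 0; 0, 6] *ᵥ e P)
    (hσm : ∀ P : W.geomTorsion (7 : ℕ), e (σm • P) = -e P)
    {X : Matrix (Fin 2) (Fin 2) (ZMod 7)} (hX : X 0 1 ≠ 0) (hσx : ∀ P : W.geomTorsion (7 : ℕ), e (σx • P) = X *ᵥ e P)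
    (hrank : Nat.card {d : ClassGroup (𝓞 ↥(fixedField (Subgroup.zpowers (absRestrictNormalHom (W.divisionField 7) σs)))) // d ^ 7 = 1} =
      Nat.card {d : ClassGroup (𝓞 ↥(fixedField (Subgroup.zpowers (absRestrictNormalHom (W.divisionField 7) σm) ⊔
        Subgroup.zpowers (absRestrictNormalHom (W.divisionField 7) σs)))) // d ^ 7 = 1})
    (h4 : ∀ (𝔮 : Ideal (𝓞 ↥(W.divisionField 7))) [𝔮.IsMaximal], ((7 : ℕ) : 𝓞 ↥(W.divisionField 7)) ∈ 𝔮 →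
      4 ∣ Nat.card (𝔮.inertia (↥(W.divisionField 7) ≃ₐ[ℚ] ↥(W.divisionField 7)))) :
    MissingUpperBoundAt W 7 :=
  RankEqConjAUpperDoors.missingUpperBoundAt_tame_of_rankEq W hKatoA hGZK hmod 7 (by norm_num) hr hadd hT hirr
    (RankEqualityRoad.not_dvd_card_gal_of_nonsplitCartanNormalizer W 7 (by norm_num) e hε he)
    e σs σm σx (by simp) (by simp) hσs hσm hX hσx hrank
    (fun 𝔮 _ h𝔮 => RankEqualityRoad.neg_one_mem_inertia_of_four_dvd_card_inertia W 7 (by norm_num) e hε he σm hσm 𝔮 (h4 𝔮 h𝔮))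

/-- Record for `163072bq1` @ 7 (`N = 2^8·7^2·13`; Cremona `r_an = 0`; (t′) at 7, defect 4; image `7Nn`): `hrank` numerics =
conjA-anchor g23 kit j334924 (degree-48 `ℚ(P)`, GRH); `h4`: `#I(𝔮|7) = 48` (7 totally ramified in `ℚ(P)`, kit j334874, exact). -/
theorem missingUpperBoundAt_g163072bq1_7_of_rankEq
    (hKatoA : Kato2004.rankZero_padicValNat_sha_add_padicValNat_tamagawa_le_of_additive_potGood_of_irreducible_of_fineSelmerDual_fg)
    (hGZK : rank_eq_analyticRank_of_analyticRank_le_one) (hmod : hasEntireLFunction_rat)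
    {W : WeierstrassCurve ℚ} [W.IsElliptic] [W.IsGloballyMinimal] (hWeq : W = (⟨0, (-1), 0, (-48043), (-4040329)⟩ : WeierstrassCurve ℚ))
    (hr : W.analyticRank = 0)
    (e : W.geomTorsion (7 : ℕ) ≃+ (Fin 2 → ZMod 7)) {ε : ZMod 7} (hε : ¬ IsSquare ε)
    (he : ∀ σ : absoluteGaloisGroup ℚ, ∃ M ∈ nonsplitCartanNormalizer ε, ∀ P : W.geomTorsion (7 : ℕ), e (σ • P) = M *ᵥ e P)
    (σs σm σx : absoluteGaloisGroup ℚ)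
    (hσs : ∀ P : W.geomTorsion (7 : ℕ), e (σs • P) = !![1, 0; 0, 6] *ᵥ e P)
    (hσm : ∀ P : W.geomTorsion (7 : ℕ), e (σm • P) = -e P)
    {X : Matrix (Fin 2) (Fin 2) (ZMod 7)} (hX : X 0 1 ≠ 0) (hσx : ∀ P : W.geomTorsion (7 : ℕ), e (σx • P) = X *ᵥ e P)
    (hrank : Nat.card {d : ClassGroup (𝓞 ↥(fixedField (Subgroup.zpowers (absRestrictNormalHom (W.divisionField 7) σs)))) // d ^ 7 = 1} =
      Nat.card {d : ClassGroup (𝓞 ↥(fixedField (Subgroup.zpowers (absRestrictNormalHom (W.divisionField 7) σm) ⊔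
        Subgroup.zpowers (absRestrictNormalHom (W.divisionField 7) σs)))) // d ^ 7 = 1})
    (h4 : ∀ (𝔮 : Ideal (𝓞 ↥(W.divisionField 7))) [𝔮.IsMaximal], ((7 : ℕ) : 𝓞 ↥(W.divisionField 7)) ∈ 𝔮 →
      4 ∣ Nat.card (𝔮.inertia (↥(W.divisionField 7) ≃ₐ[ℚ] ↥(W.divisionField 7)))) :
    MissingUpperBoundAt W 7 := by
  subst hWeq
  haveI : Fact (Nat.Prime 7) := ⟨by norm_num⟩
  exact missingUpperBoundAt_seven_tame_of_nonsplitCartan_of_rankEq_of_four_dvd _ hKatoA hGZK hmod hr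
    TameUpperUnitTwistRecords.addv_g163072bq1_7 TameUpperUnitTwistRecords.subTprime_g163072bq1_7 TameUpperUnitTwistRecords.irr_g163072bq1_7
    e hε he σs σm σx hσs hσm hX hσx hrank h4

/-- Record for `163072cb1` @ 7 (`N = 2^8·7^2·13`; Cremona `r_an = 0`; (t′) at 7, defect 4; image `7Nn`; SAME fields kx, ℚ(P) as 163072bq1 (kit j334874)): `hrank` numerics =
conjA-anchor g23 kit j334924 (degree-48 `ℚ(P)`, GRH); `h4`: `#I(𝔮|7) = 48` (7 totally ramified in `ℚ(P)`, kit j334874, exact). -/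
theorem missingUpperBoundAt_g163072cb1_7_of_rankEq
    (hKatoA : Kato2004.rankZero_padicValNat_sha_add_padicValNat_tamagawa_le_of_additive_potGood_of_irreducible_of_fineSelmerDual_fg)
    (hGZK : rank_eq_analyticRank_of_analyticRank_le_one) (hmod : hasEntireLFunction_rat)
    {W : WeierstrassCurve ℚ} [W.IsElliptic] [W.IsGloballyMinimal] (hWeq : W = (⟨0, 1, 0, (-9416493), (-11133745141)⟩ : WeierstrassCurve ℚ))
    (hr : W.analyticRank = 0)
    (e : W.geomTorsion (7 : ℕ) ≃+ (Fin 2 → ZMod 7)) {ε : ZMod 7} (hε : ¬ IsSquare ε)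
    (he : ∀ σ : absoluteGaloisGroup ℚ, ∃ M ∈ nonsplitCartanNormalizer ε, ∀ P : W.geomTorsion (7 : ℕ), e (σ • P) = M *ᵥ e P)
    (σs σm σx : absoluteGaloisGroup ℚ)
    (hσs : ∀ P : W.geomTorsion (7 : ℕ), e (σs • P) = !![1, 0; 0, 6] *ᵥ e P)
    (hσm : ∀ P : W.geomTorsion (7 : ℕ), e (σm • P) = -e P)
    {X : Matrix (Fin 2) (Fin 2) (ZMod 7)} (hX : X 0 1 ≠ 0) (hσx : ∀ P : W.geomTorsion (7 : ℕ), e (σx • P) = X *ᵥ e P)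
    (hrank : Nat.card {d : ClassGroup (𝓞 ↥(fixedField (Subgroup.zpowers (absRestrictNormalHom (W.divisionField 7) σs)))) // d ^ 7 = 1} =
      Nat.card {d : ClassGroup (𝓞 ↥(fixedField (Subgroup.zpowers (absRestrictNormalHom (W.divisionField 7) σm) ⊔
        Subgroup.zpowers (absRestrictNormalHom (W.divisionField 7) σs)))) // d ^ 7 = 1})
    (h4 : ∀ (𝔮 : Ideal (𝓞 ↥(W.divisionField 7))) [𝔮.IsMaximal], ((7 : ℕ) : 𝓞 ↥(W.divisionField 7)) ∈ 𝔮 →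
      4 ∣ Nat.card (𝔮.inertia (↥(W.divisionField 7) ≃ₐ[ℚ] ↥(W.divisionField 7)))) :
    MissingUpperBoundAt W 7 := by
  subst hWeq
  haveI : Fact (Nat.Prime 7) := ⟨by norm_num⟩
  exact missingUpperBoundAt_seven_tame_of_nonsplitCartan_of_rankEq_of_four_dvd _ hKatoA hGZK hmod hr
    TameUpperUnitTwistRecords.addv_g163072cb1_7 TameUpperUnitTwistRecords.subTprime_g163072cb1_7 TameUpperUnitTwistRecords.irr_g163072cb1_7
    e hε he σs σm σx hσs hσm hX hσx hrank h4

/-- Record for `163072k1` @ 7 (`N = 2^8·7^2·13`; Cremona `r_an = 0`; (t′) at 7, defect 4; image `7Nn`; ♯ row; ℚ(P) = the sign twist F(ix) of 163072bq1's (kit j334874)): `hrank` numerics =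
conjA-anchor g23 kit j334924 (degree-48 `ℚ(P)`, GRH); `h4`: `#I(𝔮|7) = 48` (7 totally ramified in `ℚ(P)`, kit j334874, exact). -/
theorem missingUpperBoundAt_g163072k1_7_of_rankEq
    (hKatoA : Kato2004.rankZero_padicValNat_sha_add_padicValNat_tamagawa_le_of_additive_potGood_of_irreducible_of_fineSelmerDual_fg)
    (hGZK : rank_eq_analyticRank_of_analyticRank_le_one) (hmod : hasEntireLFunction_rat)
    {W : WeierstrassCurve ℚ} [W.IsElliptic] [W.IsGloballyMinimal] (hWeq : W = (⟨0, (-1), 0, (-2354123), (-1390541081)⟩ : WeierstrassCurve ℚ))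
    (hr : W.analyticRank = 0)
    (e : W.geomTorsion (7 : ℕ) ≃+ (Fin 2 → ZMod 7)) {ε : ZMod 7} (hε : ¬ IsSquare ε)
    (he : ∀ σ : absoluteGaloisGroup ℚ, ∃ M ∈ nonsplitCartanNormalizer ε, ∀ P : W.geomTorsion (7 : ℕ), e (σ • P) = M *ᵥ e P)
    (σs σm σx : absoluteGaloisGroup ℚ)
    (hσs : ∀ P : W.geomTorsion (7 : ℕ), e (σs • P) = !![1, 0; 0, 6] *ᵥ e P)
    (hσm : ∀ P : W.geomTorsion (7 : ℕ), e (σm • P) = -e P)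
    {X : Matrix (Fin 2) (Fin 2) (ZMod 7)} (hX : X 0 1 ≠ 0) (hσx : ∀ P : W.geomTorsion (7 : ℕ), e (σx • P) = X *ᵥ e P)
    (hrank : Nat.card {d : ClassGroup (𝓞 ↥(fixedField (Subgroup.zpowers (absRestrictNormalHom (W.divisionField 7) σs)))) // d ^ 7 = 1} =
      Nat.card {d : ClassGroup (𝓞 ↥(fixedField (Subgroup.zpowers (absRestrictNormalHom (W.divisionField 7) σm) ⊔
        Subgroup.zpowers (absRestrictNormalHom (W.divisionField 7) σs)))) // d ^ 7 = 1})
    (h4 : ∀ (𝔮 : Ideal (𝓞 ↥(W.divisionField 7))) [𝔮.IsMaximal], ((7 : ℕ) : 𝓞 ↥(W.divisionField 7)) ∈ 𝔮 →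
      4 ∣ Nat.card (𝔮.inertia (↥(W.divisionField 7) ≃ₐ[ℚ] ↥(W.divisionField 7)))) :
    MissingUpperBoundAt W 7 := by
  subst hWeq
  haveI : Fact (Nat.Prime 7) := ⟨by norm_num⟩
  exact missingUpperBoundAt_seven_tame_of_nonsplitCartan_of_rankEq_of_four_dvd _ hKatoA hGZK hmod hr
    TameUpperUnitTwistRecords.addv_g163072k1_7 TameUpperUnitTwistRecords.subTprime_g163072k1_7 TameUpperUnitTwistRecords.irr_g163072k1_7
    e hε he σs σm σx hσs hσm hX hσx hrank h4

end Summit.BirchSwinnertonDyer.BirchSwinnertonDyer.Theorems.TameRankEqRecordsSeven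

end
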